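import Literature.NumberTheory.EllipticCurves.WeierstrassAddAtlas
import Mathlib.AlgebraicGeometry.AlgClosed.Basic
import Literature.AlgebraicGeometry.Motives.AlgPointsSeparate
import HarnessLib

/-!
# Gluing a morphism between Weierstrass cubics from local charts computing a prescribed point map

Let `W`, `W'` be elliptic curves over a field `K`, `E_W, E_{W'} ⊂ ℙ²_K` their plane cubics
(`WeierstrassCurve.scheme`) and `K̄ = AlgebraicClosure K`. A non-constant rational map `E_W → E_{W'}`
is a morphism (Silverman, *AEC* II.2.1) and is given locally by rational formulas; to obtain it as a
morphism of SCHEMES in the tree one exhibits local charts and glues, exactly as the chord–tangent law was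
glued in `EllipticCurves/WeierstrassAddAtlas` (Silverman, *AEC* III.3.6, proof and Remark 3.6.1). This
file is the one-variable version of that gluing step, for a prescribed map `g : W(K̄) → W'(K̄)` on
geometric points (typically an isogeny in the sense of `EllipticCurves/Isogeny`):

* `WeierstrassCurve.MapChart W W' g` — a *map chart*: an affine `K`-scheme `Spec S` with an open immersion
  `ι : Spec S ↪ E_W` over `K` and a `K`-morphism `μ : Spec S → E_{W'}` which **computes `g` on
  `K̄`-points**: `μ(β) = g (ι β)` for every `K̄`-point `β` of `Spec S` (dictionary `toGeomPoint = pointEquiv⁻¹`);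
* `WeierstrassCurve.MapAtlas W W' g J` — a family of map charts whose sources cover `E_W`;
* `MapAtlas.compatible` — any two map charts agree on the overlap of their sources (reduced source of finite
  type, separated target, equal on `K̄`-points: `Motives/AlgPointsSeparate`);
* `MapAtlas.mapHom : E_W → E_{W'}` — the glued `K`-morphism (Mathlib `Scheme.Cover.glueMorphisms`), with
  `MapAtlas.toGeomPoint_mapHom` / `MapAtlas.pointEquiv_comp_mapHom`: **on `K̄`-points it is `g`**;
* `MapAtlas.covers_of_forall_geomPoint` — the covering condition follows from its restriction to `K̄`-points
  (every closed point of the finite-type `K`-scheme `E_W` carries a `K̄`-point, and closed points are dense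
  in closed subsets: `E_W` is Jacobson, Stacks 01TB), the form in which explicit formulas verify it.

## References

* J. H. Silverman, *The Arithmetic of Elliptic Curves*, 2nd ed., GTM 106 (2009): II.2.1, III.3.6 and
  Remark 3.6.1, III.4.8. [SilvermanAEC2009]
* U. Görtz, T. Wedhorn, *Algebraic Geometry I*, 2nd ed. (2020), Prop. 3.35 and Prop. 9.2 (gluing of
  morphisms; morphisms determined on a dense set of points), Stacks 01TB. [GortzWedhorn2020]

## Design

`namespace WeierstrassCurve`; as in `WeierstrassAddAtlas`, charts carry scheme-level morphisms out of
`Spec S` with their `K`-structure equations (`ι_over`, `μ_over`); `K̄`-points of `Spec S` over `K` are the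
`specPoint β`, `β : S →ₐ[K] K̄`. No named facts.
-/

noncomputable section

open CategoryTheory AlgebraicGeometry Limits
open Literature.AlgebraicGeometry.Motives

universe u v

-- tree idiom for scheme-level rewriting through `Over`/pullback API (cf. `WeierstrassAddAtlas`)
set_option backward.isDefEq.respectTransparency false

namespace WeierstrassCurve

variable {K : Type u} [Field K] (W W' : WeierstrassCurve K) [W.IsElliptic] [W'.IsElliptic]

local notation "K̄" => AlgebraicClosure K

/-! ### Map charts -/

/-- **A map chart for a prescribed point map `g : W(K̄) → W'(K̄)`**: an affine open `ι : Spec S ↪ E_W`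
over `K` with a `K`-morphism `μ : Spec S → E_{W'}` computing `g` on `K̄`-points (Silverman, *AEC* II.2.1,
III.4: "a rational map is given locally by rational functions"). [cite: SilvermanAEC2009, III.3.6 and Remark 3.6.1] -/
structure MapChart (g : W.geomPoints → W'.geomPoints) where
  /-- The coordinate ring of the source. -/
  S : Type u
  [commRing : CommRing S]
  [algebra : Algebra K S]
  /-- The open immersion of the source into `E_W`. -/
  ι : Spec (CommRingCat.of S) ⟶ W.scheme.left
  [isOpenImmersion : IsOpenImmersion ι]
  /-- `ι` is a morphism over `K`. -/
  ι_over : ι ≫ W.scheme.hom = Spec.map (CommRingCat.ofHom (algebraMap K S))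
  /-- The value morphism `Spec S → E_{W'}`. -/
  μ : Spec (CommRingCat.of S) ⟶ W'.scheme.left
  /-- `μ` is a morphism over `K`. -/
  μ_over : μ ≫ W'.scheme.hom = Spec.map (CommRingCat.ofHom (algebraMap K S))
  /-- The chart computes `g` on `K̄`-points. -/
  isMap : ∀ β : S →ₐ[K] AlgebraicClosure K,
    W'.toGeomPoint (specPoint μ μ_over β) = g (W.toGeomPoint (specPoint ι ι_over β))

attribute [instance] MapChart.commRing MapChart.algebra

variable {W W'} in
/-- The source of a map chart is an open of `E_W`. [folklore] -/
instance MapChart.isOpenImmersion_ι {g : W.geomPoints → W'.geomPoints} (L : W.MapChart W' g) :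
    IsOpenImmersion L.ι := L.isOpenImmersion

/-! ### Atlases and the glued morphism -/

/-- **An atlas of map charts**: map charts for `g` whose sources cover `E_W`. [cite: SilvermanAEC2009, III.3.6 and Remark 3.6.1] -/
structure MapAtlas (g : W.geomPoints → W'.geomPoints) (J : Type v) where
  /-- The map charts. -/
  chart : J → W.MapChart W' g
  /-- Their sources cover `E_W`. -/
  covers : ∀ x : W.scheme.left, ∃ (j : J) (y : Spec (CommRingCat.of (chart j).S)), (chart j).ι y = x

namespace MapAtlas

variable {W W'} {g : W.geomPoints → W'.geomPoints} {J : Type v} (A : W.MapAtlas W' g J)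

/-- The open cover of `E_W` by the sources of the charts. [folklore] -/
def cover : W.scheme.left.OpenCover :=
  Scheme.Cover.mkOfCovers J (fun j ↦ Spec (CommRingCat.of (A.chart j).S)) (fun j ↦ (A.chart j).ι) A.covers

/-- The maps of the cover are the chart immersions (`rfl`). [folklore] -/
theorem cover_f (j : J) : A.cover.f j = (A.chart j).ι := rfl

/-- **Two map charts agree on the overlap of their sources.** Both composites
`Spec Sⱼ ×_{E} Spec Sₖ → Spec Sⱼ → E_{W'}` and `→ Spec Sₖ → E_{W'}` are `K`-morphisms from a reduced
`K`-scheme of finite type to the separated `E_{W'}` taking the same values `g(·)` on `K̄`-points, hence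
are equal (`SchemeOver.hom_ext_of_forall_algPoints`). [cite: GortzWedhorn2020, Prop. 9.2] -/
theorem compatible (j k : J) :
    pullback.fst (A.chart j).ι (A.chart k).ι ≫ (A.chart j).μ =
      pullback.snd (A.chart j).ι (A.chart k).ι ≫ (A.chart k).μ := by
  set Lj := A.chart j
  set Lk := A.chart k
  -- the overlap as a `K`-scheme and the two maps as `K`-morphisms
  let P : SchemeOver K := Over.mk (pullback.fst Lj.ι Lk.ι ≫ Lj.ι ≫ W.scheme.hom)
  haveI : AlgebraicGeometry.IsReduced P.left := isReduced_of_isOpenImmersion (pullback.fst Lj.ι Lk.ι ≫ Lj.ι)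
  haveI : LocallyOfFiniteType P.hom := by
    change LocallyOfFiniteType (pullback.fst Lj.ι Lk.ι ≫ Lj.ι ≫ W.scheme.hom)
    infer_instance
  let f : P ⟶ W'.scheme := Over.homMk (pullback.fst Lj.ι Lk.ι ≫ Lj.μ) (by
    change (pullback.fst Lj.ι Lk.ι ≫ Lj.μ) ≫ W'.scheme.hom = pullback.fst Lj.ι Lk.ι ≫ Lj.ι ≫ _
    rw [Category.assoc, MapChart.μ_over, MapChart.ι_over])
  let g' : P ⟶ W'.scheme := Over.homMk (pullback.snd Lj.ι Lk.ι ≫ Lk.μ) (by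
    change (pullback.snd Lj.ι Lk.ι ≫ Lk.μ) ≫ W'.scheme.hom = pullback.fst Lj.ι Lk.ι ≫ Lj.ι ≫ _
    rw [Category.assoc, MapChart.μ_over, ← MapChart.ι_over Lk, ← pullback.condition_assoc,
      MapChart.ι_over])
  suffices hfg : f = g' from congrArg CommaMorphism.left hfg
  refine SchemeOver.hom_ext_of_forall_algPoints (AlgebraicClosure K) fun q ↦ ?_
  set ql : Spec (CommRingCat.of K̄) ⟶ pullback Lj.ι Lk.ι := q.left with hql
  have hq : ql ≫ pullback.fst Lj.ι Lk.ι ≫ Lj.ι ≫ W.scheme.hom =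
      Spec.map (CommRingCat.ofHom (algebraMap K K̄)) := Over.w q
  -- the two points of the sources under `q`
  obtain ⟨βj, hβj⟩ := exists_eq_specMap (K := K) (ql ≫ pullback.fst Lj.ι Lk.ι) (by
    rw [Category.assoc, ← MapChart.ι_over]
    exact hq)
  obtain ⟨βk, hβk⟩ := exists_eq_specMap (K := K) (ql ≫ pullback.snd Lj.ι Lk.ι) (by
    rw [Category.assoc, ← MapChart.ι_over, ← pullback.condition_assoc]
    exact hq)
  -- the values
  have hvj : q ≫ f = specPoint Lj.μ Lj.μ_over βj := by
    refine Over.OverMorphism.ext ?_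
    rw [Over.comp_left, specPoint_left, ← hβj]
    rfl
  have hvk : q ≫ g' = specPoint Lk.μ Lk.μ_over βk := by
    refine Over.OverMorphism.ext ?_
    rw [Over.comp_left, specPoint_left, ← hβk]
    rfl
  -- the two source points have the same image in `E_W`
  have hsrc : specPoint Lj.ι Lj.ι_over βj = specPoint Lk.ι Lk.ι_over βk := by
    refine Over.OverMorphism.ext ?_
    rw [specPoint_left, specPoint_left, ← hβj, ← hβk, Category.assoc, Category.assoc, pullback.condition]
  apply W'.toGeomPoint_bijective.1
  rw [hvj, hvk, Lj.isMap βj, Lk.isMap βk, hsrc]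

/-- `compatible`, stated for the maps of the cover. [folklore] -/
theorem compatible' (j k : A.cover.I₀) :
    pullback.fst (A.cover.f j) (A.cover.f k) ≫ (A.chart j).μ =
      pullback.snd (A.cover.f j) (A.cover.f k) ≫ (A.chart k).μ :=
  A.compatible j k

/-- The glued underlying morphism of schemes `E_W → E_{W'}` (Mathlib `Scheme.Cover.glueMorphisms`).
[cite: GortzWedhorn2020, Prop. 3.35] -/
def mapHomLeft : W.scheme.left ⟶ W'.scheme.left :=
  A.cover.glueMorphisms (fun j ↦ (A.chart j).μ) A.compatible'

/-- The glued morphism restricted to the source of a chart is the value morphism. [folklore] -/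
theorem ι_mapHomLeft (j : J) : (A.chart j).ι ≫ A.mapHomLeft = (A.chart j).μ :=
  A.cover.ι_glueMorphisms _ _ j

/-- The glued morphism is over `Spec K`. [folklore] -/
theorem mapHomLeft_over : A.mapHomLeft ≫ W'.scheme.hom = W.scheme.hom := by
  refine Scheme.Cover.hom_ext A.cover _ _ fun j ↦ ?_
  change (A.chart j).ι ≫ A.mapHomLeft ≫ W'.scheme.hom = (A.chart j).ι ≫ W.scheme.hom
  rw [← Category.assoc, ι_mapHomLeft, MapChart.μ_over, MapChart.ι_over]

/-- **The morphism `E_W → E_{W'}` over `K` glued from an atlas of map charts.**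
[cite: SilvermanAEC2009, III.3.6 and Remark 3.6.1] -/
def mapHom : W.scheme ⟶ W'.scheme :=
  Over.homMk A.mapHomLeft A.mapHomLeft_over

/-- The glued morphism restricted to the source of a chart is the value morphism. [folklore] -/
theorem ι_comp_mapHom_left (j : J) : (A.chart j).ι ≫ A.mapHom.left = (A.chart j).μ :=
  A.ι_mapHomLeft j

/-- **The glued morphism is `g` on `K̄`-points**: for every `K̄`-point `p` of `E_W`,
`mapHom (p) = g p` in `W'(K̄)` (the point lies in the source of some chart, which computes `g`).
[cite: SilvermanAEC2009, III.3.6 and Remark 3.6.1] -/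
theorem toGeomPoint_mapHom (p : AlgPoints W.scheme K̄) :
    W'.toGeomPoint (p ≫ A.mapHom) = g (W.toGeomPoint p) := by
  set pl : Spec (CommRingCat.of K̄) ⟶ W.scheme.left := p.left with hpl
  obtain ⟨j, y, hy⟩ := A.covers (pl (IsLocalRing.closedPoint K̄))
  have hrange : Set.range pl ⊆ Set.range (A.chart j).ι := by
    rintro _ ⟨s, hs⟩
    rw [← hs, AddAtlas.eq_closedPoint s]
    exact ⟨y, hy⟩
  let ℓ : Spec (CommRingCat.of K̄) ⟶ Spec (CommRingCat.of (A.chart j).S) :=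
    IsOpenImmersion.lift (A.chart j).ι pl hrange
  have hℓ : ℓ ≫ (A.chart j).ι = pl := IsOpenImmersion.lift_fac _ _ _
  have hpo : pl ≫ W.scheme.hom = Spec.map (CommRingCat.ofHom (algebraMap K K̄)) := Over.w p
  obtain ⟨β, hβ⟩ := exists_eq_specMap (K := K) ℓ (by
    rw [← MapChart.ι_over, ← Category.assoc, hℓ]
    exact hpo)
  have hp : p = specPoint (A.chart j).ι (A.chart j).ι_over β := by
    refine Over.OverMorphism.ext ?_
    rw [specPoint_left, ← hβ, hℓ]
  have hval : p ≫ A.mapHom = specPoint (A.chart j).μ (A.chart j).μ_over β := by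
    refine Over.OverMorphism.ext ?_
    rw [Over.comp_left, specPoint_left, ← hβ]
    change pl ≫ A.mapHom.left = ℓ ≫ (A.chart j).μ
    rw [← hℓ, Category.assoc, ι_comp_mapHom_left]
  rw [hval, (A.chart j).isMap β, ← hp]

/-- **`[P] ≫ mapHom = [g P]`**: the glued morphism in terms of Mathlib's points `W(K̄)`.
[cite: SilvermanAEC2009, III.3.6 and Remark 3.6.1] -/
theorem pointEquiv_comp_mapHom (P : W.geomPoints) :
    W.pointEquiv (L := K̄) P ≫ A.mapHom = W'.pointEquiv (L := K̄) (g P) := by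
  have h := A.toGeomPoint_mapHom (W.pointEquiv (L := K̄) P)
  rw [toGeomPoint_pointEquiv] at h
  rw [← W'.pointEquiv_toGeomPoint (W.pointEquiv (L := K̄) P ≫ A.mapHom), h]

end MapAtlas

/-! ### The covering condition from `K̄`-points -/

section Covers

variable {W W'} {g : W.geomPoints → W'.geomPoints} {J : Type v} (chart : J → W.MapChart W' g)

/-- **Open subsets of `E_W` containing every `K̄`-point are everything.** `E_W` is of finite type over
`K`, hence Jacobson (Stacks 01TB): a non-empty closed subset contains a closed point, and through a closed
point passes a `K̄`-point (`Motives/AlgPointsSeparate.exists_point_through_closedPoint`).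
[cite: GortzWedhorn2020, Prop. 3.35 and Stacks 01TB] -/
theorem eq_univ_of_forall_geomPoint_mem {U : Set W.scheme.left} (hU : IsOpen U)
    (h : ∀ P : AlgPoints W.scheme K̄, P.left (IsLocalRing.closedPoint K̄) ∈ U) : U = Set.univ := by
  have : JacobsonSpace W.scheme.left := LocallyOfFiniteType.jacobsonSpace W.scheme.hom
  by_contra hne
  have hZ : IsClosed Uᶜ := hU.isClosed_compl
  have hZne : (Uᶜ).Nonempty := Set.nonempty_compl.mpr hne
  -- a closed point in the non-empty closed complement
  have hcl : (Uᶜ ∩ closedPoints W.scheme.left).Nonempty :=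
    nonempty_inter_closedPoints hZne hZ.isLocallyClosed
  obtain ⟨x, hxU, hxcl⟩ := hcl
  rw [mem_closedPoints_iff] at hxcl
  obtain ⟨τ, hτ⟩ := exists_point_through_closedPoint W.scheme.hom K̄ hxcl
  let P : AlgPoints W.scheme K̄ := Over.homMk (Spec.map τ ≫ W.scheme.left.fromSpecResidueField x) hτ
  have hPx : P.left (IsLocalRing.closedPoint K̄) = x := by
    change (Spec.map τ ≫ W.scheme.left.fromSpecResidueField x) (IsLocalRing.closedPoint K̄) = x
    rw [Scheme.Hom.comp_apply]
    exact Scheme.fromSpecResidueField_apply x _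
  exact hxU (hPx ▸ h P)

/-- **An atlas from charts covering the `K̄`-points.** If every `K̄`-point of `E_W` factors through the
source of some chart, the sources cover `E_W`. [cite: GortzWedhorn2020, Prop. 3.35 and Stacks 01TB] -/
theorem covers_of_forall_geomPoint
    (h : ∀ P : AlgPoints W.scheme K̄, ∃ (j : J) (β : (chart j).S →ₐ[K] K̄),
      specPoint (chart j).ι (chart j).ι_over β = P) :
    ∀ x : W.scheme.left, ∃ (j : J) (y : Spec (CommRingCat.of (chart j).S)), (chart j).ι y = x := by
  set U : Set W.scheme.left := ⋃ j, Set.range (chart j).ι with hUdef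
  have hU : IsOpen U := isOpen_iUnion fun j ↦ (chart j).ι.isOpenEmbedding.isOpen_range
  have hall : U = Set.univ := by
    refine eq_univ_of_forall_geomPoint_mem (W := W) hU fun P ↦ ?_
    obtain ⟨j, β, hβ⟩ := h P
    refine Set.mem_iUnion.mpr ⟨j, ?_⟩
    rw [← hβ, specPoint_left, Scheme.Hom.comp_apply]
    exact ⟨_, rfl⟩
  intro x
  have hx : x ∈ U := by rw [hall]; trivial
  obtain ⟨j, y, hy⟩ := Set.mem_iUnion.mp hx
  exact ⟨j, y, hy⟩

end Covers

end WeierstrassCurve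

end
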